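import Mathlib
import Summits.KontsevichZagierPeriods.Zeta5Search.FamilyTiers
import HarnessLib

/-!
# ζ(5) search — the split of `CellAtlas.FamilyCellB` at its exceptional parameter `t = 5` (HONEST FRAMING: systematic search; no irrationality claim unless certified)

Cell `pub-zeta5`, GEN-2 seat generation 19.  Census g11's family cell B (`RecordCellAtlas.FamilyCellB`: for `t ≥ 5`, `n ≥ 2` and primes
`(t+1)n < p < (t+3/2)n`, `v_p(Cas₇(bFam t n)) ≥ −6`; `t = 11` is the record cell `RecordCellB`, a theorem) is the last of the three census
family cells (A, B, D) that is not yet a tree theorem, and the two halves of its parameter range close by DIFFERENT mechanisms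
(REPORT-gen2-g9 §9, P1 g8's README "out of scope: FamilyCellB at t = 5"):

* `t ≥ 6` (`FamilyCellB6`): the AFFINE mechanism of `AtlasCellRecB` (maximal pole order `m = −5`, two orbit types `(−1,−5,1)`,
  `(0,−6,1)`, collinear orbit vectors, moment range `N = 5`), uniformly in `t` — P1 g8's `afffam` analysis reports the cell
  `affine-formal` from `t₀ = 6` with ONE witness class `x = (t+1)n` (6 615 instances, `t ≤ 66`, `n ≤ 30`, 0 exceptions);
* `t = 5` (`FamilyCellBAt5`, the ray `n·(23; 11,…,5)`, primes `6n < p < 13n/2`): the pole order is `6` (deep classes `(0,−6,0)` below the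
  affine level) and the cell is instead a ZERO-REGIME TYPE-SPACE WINDOW with `M = 6` (`ResidueLaw.TypeSpaceLawZero`, a theorem): bound
  `6 − 2M = −6` (gen-2 g19, `T1Rays.FamB5WindowZ6` of `FamB5Windows.lean`).

This file only types the two halves and proves that they are EXACTLY the two halves (`familyCellB_of_split` and the two converses).
`p`-adic bookkeeping of rational numbers; nothing here bears on irrationality.
-/

noncomputable section

namespace Summit.KontsevichZagierPeriods.Zeta5Search.FamilyTiers

open Summit.KontsevichZagierPeriods.Zeta5Search.CasoratianValuation (casoratian)
open Summit.KontsevichZagierPeriods.Zeta5Search.CellAtlas (bFam FamilyCellB)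

/-- **FamilyCellB from `t = 6`** (the affine half): for `t ≥ 6`, `n ≥ 2` and primes `(t+1)n < p < (t+3/2)n`, `v_p(Cas₇(bFam t n)) ≥ −6`. -/
@[conjecture] def FamilyCellB6 : Prop :=
  ∀ t n p : ℕ, 6 ≤ t → 2 ≤ n → p.Prime → (t + 1) * n < p → 2 * p < (2 * t + 3) * n → casoratian (bFam t n) 7 ≠ 0 →
    (-6 : ℤ) ≤ padicValRat p (casoratian (bFam t n) 7)

/-- **FamilyCellB at `t = 5`** (the zero-regime half; ray `n·(23; 11,10,9,8,7,6,5)`): for `n ≥ 2` and primes `6n < p < 13n/2`,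
`v_p(Cas₇(bFam 5 n)) ≥ −6`. -/
@[conjecture] def FamilyCellBAt5 : Prop :=
  ∀ n p : ℕ, 2 ≤ n → p.Prime → 6 * n < p → 2 * p < 13 * n → casoratian (bFam 5 n) 7 ≠ 0 →
    (-6 : ℤ) ≤ padicValRat p (casoratian (bFam 5 n) 7)

/-- **The split**: `FamilyCellB` follows from its `t = 5` slice and its `t ≥ 6` half. -/
theorem familyCellB_of_split (h5 : FamilyCellBAt5) (h6 : FamilyCellB6) : FamilyCellB := by
  intro t n p ht hn hp h1 h2 hne
  rcases Nat.lt_or_ge t 6 with hlt | hge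
  · obtain rfl : t = 5 := by omega
    exact h5 n p hn hp (by omega) (by omega) hne
  · exact h6 t n p hge hn hp h1 h2 hne

/-- Converse, `t = 5`: the slice is an instance of `FamilyCellB`. -/
theorem familyCellBAt5_of (h : FamilyCellB) : FamilyCellBAt5 :=
  fun n p hn hp h1 h2 hne => h 5 n p le_rfl hn hp (by omega) (by omega) hne

/-- Converse, `t ≥ 6`: the affine half is a restriction of `FamilyCellB` (so the split is exact). -/
theorem familyCellB6_of (h : FamilyCellB) : FamilyCellB6 :=
  fun t n p ht hn hp h1 h2 hne => h t n p (by omega) hn hp h1 h2 hne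

end Summit.KontsevichZagierPeriods.Zeta5Search.FamilyTiers

end
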